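import Summits.QuantumFields.YangMills.Theorems.HypercubicLimit.Negative.ExtendByZero

/-!
# `HypercubicLimit` — structural support: the crux is equivalent to its ONE-FIELD version

Support file for crux `stmt-QuantumFields-8646` (`HypercubicLimit`, shared by routes PencilRigidity /
MirrorModularBoosts / CoincidenceRotationBootstrap), extracted from the standing disprover's work file
`Cruxes/HypercubicLimit/Disproof.lean` §4; builds on `Negative/ExtendByZero.lean`.

* `onlySpecies sch s₀`: the scheme renormalising every species other than `s₀` to zero;
  `latticeSchwinger_onlySpecies_of_ne` / `_self`.
* `clauses₁_of_clauses` (restriction) and `clauses_of_clauses₁` (extension by zero + `onlySpecies`).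
* `hypercubicLimit_iff_oneField`: **`HypercubicLimit` ⇔ for every compact simple `G` there are `r`, `sch` and ONE
  Schwinger family `S₁` on `ℝ⁴` (the curvature field) with E0–E4 + translations + proper-hypercubic invariance,
  convergence of the curvature `n`-point functions (verbatim the first clause of the route files' `W₁`),
  non-triviality, non-Gaussianity, `HasMassGap Δ` and `HasLatticeMassGap r sch Δ`.**  The labelled ALL-species
  packaging of the crux carries no weight beyond `HasLatticeMassGap` (which sees `(a_k, β_k, L_k)` only):
  per-species renormalisations are witness data and `c_s ≡ 0` silences every species but one. [folklore]
-/

noncomputable section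

open scoped SchwartzMap ComplexConjugate
open MeasureTheory Filter Topology Complex
open Literature.MathematicalPhysics.AQFT Literature.MathematicalPhysics.QuantumLattice
open Literature.MathematicalPhysics.QuantumFieldTheory

namespace Summit.QuantumFields.YangMills.Theorems.HypercubicLimit.Negative

/-- **Record of the dropped route decl `PencilRigidity.HypercubicLimit`** = crux stmt-QuantumFields-8646 (ledger
signature verbatim, under its original fully-qualified name; NOT a route item of PencilRigidity any more): route
PencilRigidity DROPPED its want of the shared crux at rev 4 (2026-08-16T17:35Z, statement-revised p116790), so the
gate-written `Theses/PencilRigidity.lean` stopped declaring this constant, while this append-only support file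
(statement text fixed) names it in `hypercubicLimit_iff_oneField` ("Unknown identifier" in the full builds of
2026-08-16). The crux itself is OPEN and live as `Summit.QuantumFields.YangMills.Theses.MirrorModularBoosts.HypercubicLimit`
— byte-identical definiens — whose route file IMPORTS this module (so that decl cannot be referenced here without an
import cycle). Re-declared with the original definiens solely so that this file and its importers keep elaborating;
`hypercubicLimit_iff_oneField` transfers to the live decl by `Iff.rfl` (definitional equality of the two copies). -/
def _root_.Summit.QuantumFields.YangMills.Theses.PencilRigidity.HypercubicLimit : Prop :=
  open Literature.MathematicalPhysics.QuantumLattice Literature.MathematicalPhysics.AQFT Literature.MathematicalPhysics.QuantumFieldTheory in let E := EuclideanSpace ℝ (Fin 4); ∀ (G : Type) [Group G] [TopologicalSpace G] [IsTopologicalGroup G] [CompactSpace G], IsCompactSimpleLieGroup G → letI : MeasurableSpace G := borel G; haveI : BorelSpace G := ⟨rfl⟩; ∃ (r : LatticeRep G) (sch : SpeciesScheme (YMSpecies G)) (S : LabelledSchwingerFamily (YMSpecies G) (E)), (S.IsNormalized ∧ S.IsHermitian ∧ S.HasLinearGrowth ∧ S.IsReflectionPositive ∧ S.IsSymmetric ∧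 S.HasClusterProperty ∧ (∀ (n : ℕ) (k : Fin n → YMSpecies G) (a : E) (F : SchwartzMap (Fin n → E) ℂ), IsOffDiagonal F → S n k (translateMulti a F) = S n k F) ∧ (∀ (n : ℕ) (k : Fin n → YMSpecies G) (R : E ≃ₗᵢ[ℝ] E), LinearMap.det (R.toLinearEquiv : E →ₗ[ℝ] E) = 1 → (∀ i : Fin 4, ∃ j : Fin 4, R (EuclideanSpace.single i 1) = EuclideanSpace.single j 1 ∨ R (EuclideanSpace.single i 1) = -EuclideanSpace.single j 1) → ∀ F : SchwartzMap (Fin n → E) ℂ, IsOffDiagonal F → S n k (linActMulti R F) = S n k F)) ∧ (∀ (n : ℕ), n ≠ 0 → ∀ (σ : Fin n → YMSpecies G) (f : Fin n → SchwartzMap (E) ℝ) (F : SchwartzMap (Fin n → E) ℂ), IsTensorOf F (fun i => ofRealTest (f i)) → IsOffDiagonal F → Filter.Tendsto (fun k : ℕ => ((latticeSchwinger r.ρ sch (fun s => s.F) k n σ f : ℝ) : ℂ)) Filter.atTop (nhds (S n σ F))) ∧ (∃ (F₁ G₁ : SchwartzMap (Fin 1 → E) ℂ) (H₁ : SchwartzMap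 (Fin (1 + 1) → E) ℂ), IsTimeOrdered F₁ ∧ IsTimeOrdered G₁ ∧ IsAppendTensorOf H₁ (osAdjoint F₁) G₁ ∧ S (1 + 1) (fun _ => r.curvature) H₁ ≠ S 1 (fun _ => r.curvature) (osAdjoint F₁) * S 1 (fun _ => r.curvature) G₁) ∧ (∃ (f g h : SchwartzMap (E) ℂ) (Ffgh : SchwartzMap (Fin 3 → E) ℂ) (Fgh Ffh Ffg : SchwartzMap (Fin 2 → E) ℂ) (Ff Fg Fh : SchwartzMap (Fin 1 → E) ℂ), IsTensorOf Ffgh ![f, g, h] ∧ IsOffDiagonal Ffgh ∧ IsTensorOf Fgh ![g, h] ∧ IsTensorOf Ffh ![f, h] ∧ IsTensorOf Ffg ![f, g] ∧ IsTensorOf Ff ![f] ∧ IsTensorOf Fg ![g] ∧ IsTensorOf Fh ![h] ∧ S 3 (fun _ => r.curvature) Ffgh - S 1 (fun _ => r.curvature) Ff * S 2 (fun _ => r.curvature) Fgh - S 1 (fun _ => r.curvature) Fg * S 2 (fun _ => r.curvature) Ffh - S 1 (fun _ => r.curvature) Fh * S 2 (fun _ => r.curvature) Ffg + 2 * (S 1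 (fun _ => r.curvature) Ff * S 1 (fun _ => r.curvature) Fg * S 1 (fun _ => r.curvature) Fh) ≠ 0) ∧ (∃ Δ : ℝ, 0 < Δ ∧ S.HasMassGap Δ ∧ HasLatticeMassGap r sch Δ)

section OneField

variable {ι : Type}

variable {G : Type} [Group G] [TopologicalSpace G] [IsTopologicalGroup G] [CompactSpace G]
  [MeasurableSpace G] [BorelSpace G]

/-- **Restriction**: a witness of the crux's clauses gives a one-field witness (same `r`, `sch`). [folklore] -/
theorem clauses₁_of_clauses {r : LatticeRep G} {sch : SpeciesScheme (YMSpecies G)}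
    {S : LabelledSchwingerFamily (YMSpecies G) (EuclideanSpace ℝ (Fin 4))} (h : ((S.IsNormalized ∧ S.IsHermitian ∧ S.HasLinearGrowth ∧ S.IsReflectionPositive ∧
      S.IsSymmetric ∧ S.HasClusterProperty ∧
      (∀ (n : ℕ) (k : Fin n → YMSpecies G) (a : (EuclideanSpace ℝ (Fin 4))) (F : 𝓢((Fin n → (EuclideanSpace ℝ (Fin 4))), ℂ)), IsOffDiagonal F →
        S n k (translateMulti a F) = S n k F) ∧
      (∀ (n : ℕ) (k : Fin n → YMSpecies G) (R : (EuclideanSpace ℝ (Fin 4)) ≃ₗᵢ[ℝ] (EuclideanSpace ℝ (Fin 4))),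
        LinearMap.det (R.toLinearEquiv : (EuclideanSpace ℝ (Fin 4)) →ₗ[ℝ] (EuclideanSpace ℝ (Fin 4))) = 1 →
        (∀ i : Fin 4, ∃ j : Fin 4, R (EuclideanSpace.single i 1) = EuclideanSpace.single j 1 ∨
          R (EuclideanSpace.single i 1) = -EuclideanSpace.single j 1) →
        ∀ F : 𝓢((Fin n → (EuclideanSpace ℝ (Fin 4))), ℂ), IsOffDiagonal F → S n k (linActMulti R F) = S n k F)) ∧
    (∀ (n : ℕ), n ≠ 0 → ∀ (σ : Fin n → YMSpecies G) (f : Fin n → 𝓢((EuclideanSpace ℝ (Fin 4)), ℝ))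
      (F : 𝓢((Fin n → (EuclideanSpace ℝ (Fin 4))), ℂ)), IsTensorOf F (fun i => ofRealTest (f i)) → IsOffDiagonal F →
        Tendsto (fun k : ℕ => ((latticeSchwinger r.ρ sch (fun s => s.F) k n σ f : ℝ) : ℂ))
          atTop (𝓝 (S n σ F))) ∧
    (∃ (F₁ G₁ : 𝓢((Fin 1 → (EuclideanSpace ℝ (Fin 4))), ℂ)) (H₁ : 𝓢((Fin (1 + 1) → (EuclideanSpace ℝ (Fin 4))), ℂ)),
      IsTimeOrdered F₁ ∧ IsTimeOrdered G₁ ∧ IsAppendTensorOf H₁ (osAdjoint F₁) G₁ ∧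
        S (1 + 1) (fun _ => r.curvature) H₁ ≠ S 1 (fun _ => r.curvature) (osAdjoint F₁) * S 1 (fun _ => r.curvature) G₁) ∧
    (∃ (f g h : 𝓢((EuclideanSpace ℝ (Fin 4)), ℂ)) (Ffgh : 𝓢((Fin 3 → (EuclideanSpace ℝ (Fin 4))), ℂ)) (Fgh Ffh Ffg : 𝓢((Fin 2 → (EuclideanSpace ℝ (Fin 4))), ℂ))
      (Ff Fg Fh : 𝓢((Fin 1 → (EuclideanSpace ℝ (Fin 4))), ℂ)),
      IsTensorOf Ffgh ![f, g, h] ∧ IsOffDiagonal Ffgh ∧ IsTensorOf Fgh ![g, h] ∧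
      IsTensorOf Ffh ![f, h] ∧ IsTensorOf Ffg ![f, g] ∧ IsTensorOf Ff ![f] ∧ IsTensorOf Fg ![g] ∧
      IsTensorOf Fh ![h] ∧
        S 3 (fun _ => r.curvature) Ffgh - S 1 (fun _ => r.curvature) Ff * S 2 (fun _ => r.curvature) Fgh -
          S 1 (fun _ => r.curvature) Fg * S 2 (fun _ => r.curvature) Ffh - S 1 (fun _ => r.curvature) Fh * S 2 (fun _ => r.curvature) Ffg +
          2 * (S 1 (fun _ => r.curvature) Ff * S 1 (fun _ => r.curvature) Fg * S 1 (fun _ => r.curvature) Fh) ≠ 0) ∧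
    (∃ Δ : ℝ, 0 < Δ ∧ S.HasMassGap Δ ∧ HasLatticeMassGap r sch Δ))) :
    (((restrictTo r.curvature S).toLabelled.IsNormalized ∧ (restrictTo r.curvature S).toLabelled.IsHermitian ∧ (restrictTo r.curvature S).toLabelled.HasLinearGrowth ∧ (restrictTo r.curvature S).toLabelled.IsReflectionPositive ∧
      (restrictTo r.curvature S).toLabelled.IsSymmetric ∧ (restrictTo r.curvature S).toLabelled.HasClusterProperty ∧
      (∀ (n : ℕ) (k : Fin n → Unit) (a : (EuclideanSpace ℝ (Fin 4))) (F : 𝓢((Fin n → (EuclideanSpace ℝ (Fin 4))), ℂ)), IsOffDiagonal F →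
        (restrictTo r.curvature S).toLabelled n k (translateMulti a F) = (restrictTo r.curvature S).toLabelled n k F) ∧
      (∀ (n : ℕ) (k : Fin n → Unit) (R : (EuclideanSpace ℝ (Fin 4)) ≃ₗᵢ[ℝ] (EuclideanSpace ℝ (Fin 4))),
        LinearMap.det (R.toLinearEquiv : (EuclideanSpace ℝ (Fin 4)) →ₗ[ℝ] (EuclideanSpace ℝ (Fin 4))) = 1 →
        (∀ i : Fin 4, ∃ j : Fin 4, R (EuclideanSpace.single i 1) = EuclideanSpace.single j 1 ∨
          R (EuclideanSpace.single i 1) = -EuclideanSpace.single j 1) →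
        ∀ F : 𝓢((Fin n → (EuclideanSpace ℝ (Fin 4))), ℂ), IsOffDiagonal F → (restrictTo r.curvature S).toLabelled n k (linActMulti R F) = (restrictTo r.curvature S).toLabelled n k F)) ∧
    (∀ (n : ℕ), n ≠ 0 → ∀ (f : Fin n → 𝓢((EuclideanSpace ℝ (Fin 4)), ℝ)) (F : 𝓢((Fin n → (EuclideanSpace ℝ (Fin 4))), ℂ)),
      IsTensorOf F (fun i => ofRealTest (f i)) → IsOffDiagonal F →
        Tendsto (fun k : ℕ =>
          ((latticeSchwinger r.ρ sch (fun s => s.F) k n (fun _ => r.curvature) f : ℝ) : ℂ))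
          atTop (𝓝 (restrictTo r.curvature S n F))) ∧
    (∃ (F₁ G₁ : 𝓢((Fin 1 → (EuclideanSpace ℝ (Fin 4))), ℂ)) (H₁ : 𝓢((Fin (1 + 1) → (EuclideanSpace ℝ (Fin 4))), ℂ)),
      IsTimeOrdered F₁ ∧ IsTimeOrdered G₁ ∧ IsAppendTensorOf H₁ (osAdjoint F₁) G₁ ∧
        (restrictTo r.curvature S).toLabelled (1 + 1) (fun _ => ()) H₁ ≠ (restrictTo r.curvature S).toLabelled 1 (fun _ => ()) (osAdjoint F₁) * (restrictTo r.curvature S).toLabelled 1 (fun _ => ()) G₁) ∧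
    (∃ (f g h : 𝓢((EuclideanSpace ℝ (Fin 4)), ℂ)) (Ffgh : 𝓢((Fin 3 → (EuclideanSpace ℝ (Fin 4))), ℂ)) (Fgh Ffh Ffg : 𝓢((Fin 2 → (EuclideanSpace ℝ (Fin 4))), ℂ))
      (Ff Fg Fh : 𝓢((Fin 1 → (EuclideanSpace ℝ (Fin 4))), ℂ)),
      IsTensorOf Ffgh ![f, g, h] ∧ IsOffDiagonal Ffgh ∧ IsTensorOf Fgh ![g, h] ∧
      IsTensorOf Ffh ![f, h] ∧ IsTensorOf Ffg ![f, g] ∧ IsTensorOf Ff ![f] ∧ IsTensorOf Fg ![g] ∧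
      IsTensorOf Fh ![h] ∧
        (restrictTo r.curvature S).toLabelled 3 (fun _ => ()) Ffgh - (restrictTo r.curvature S).toLabelled 1 (fun _ => ()) Ff * (restrictTo r.curvature S).toLabelled 2 (fun _ => ()) Fgh -
          (restrictTo r.curvature S).toLabelled 1 (fun _ => ()) Fg * (restrictTo r.curvature S).toLabelled 2 (fun _ => ()) Ffh - (restrictTo r.curvature S).toLabelled 1 (fun _ => ()) Fh * (restrictTo r.curvature S).toLabelled 2 (fun _ => ()) Ffg +
          2 * ((restrictTo r.curvature S).toLabelled 1 (fun _ => ()) Ff * (restrictTo r.curvature S).toLabelled 1 (fun _ => ()) Fg * (restrictTo r.curvature S).toLabelled 1 (fun _ => ()) Fh) ≠ 0) ∧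
    (∃ Δ : ℝ, 0 < Δ ∧ (restrictTo r.curvature S).toLabelled.HasMassGap Δ ∧ HasLatticeMassGap r sch Δ)) := by
  obtain ⟨hos, hconv, hnt, hng, Δ, hΔ, hgap, hlat⟩ := h
  exact ⟨osClauses_restrictTo _ hos, fun n hn f F hF hod => hconv n hn _ f F hF hod, hnt, hng,
    Δ, hΔ, hasMassGap_restrictTo _ hgap, hlat⟩

/-- The scheme keeping the renormalisations of `s₀` and renormalising every other species to `0`. [folklore] -/
def onlySpecies (sch : SpeciesScheme (YMSpecies G)) (s₀ : YMSpecies G) :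
    SpeciesScheme (YMSpecies G) :=
  { sch with c := fun s k => by classical exact if s = s₀ then sch.c s k else 0 }

omit [Group G] [TopologicalSpace G] [IsTopologicalGroup G] [CompactSpace G] [BorelSpace G] in
/-- `smearedLatticeField_zero_c` (auxiliary, see the module docstring). [folklore] -/
theorem smearedLatticeField_zero_c (O : LGConfig 4 G → ℝ)
    (Λ : Finset (Literature.Probability.LatticeModels.Site 4)) (a m : ℝ) (f : 𝓢((EuclideanSpace ℝ (Fin 4)), ℝ))
    (U : LGConfig 4 G) : smearedLatticeField O Λ a 0 m f U = 0 := by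
  simp [smearedLatticeField]

/-- With a species of zero multiplicative renormalisation in the string, the lattice `n`-point
function vanishes. [folklore] -/
theorem latticeSchwinger_onlySpecies_of_ne (r : LatticeRep G) (sch : SpeciesScheme (YMSpecies G))
    (s₀ : YMSpecies G) (k n : ℕ) (σ : Fin n → YMSpecies G) (f : Fin n → 𝓢((EuclideanSpace ℝ (Fin 4)), ℝ)) {i₀ : Fin n}
    (hi₀ : σ i₀ ≠ s₀) :
    latticeSchwinger r.ρ (onlySpecies sch s₀) (fun s => s.F) k n σ f = 0 := by
  unfold latticeSchwinger
  have h0 : (onlySpecies sch s₀).c (σ i₀) k = 0 := by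
    simp [onlySpecies, hi₀]
  have : ∀ U : GaugeConfig 4 ((onlySpecies sch s₀).side k) G,
      ∏ i, smearedLatticeField ((fun s : YMSpecies G => s.F) (σ i))
        (Literature.Probability.LatticeModels.box 4 ((onlySpecies sch s₀).L k))
        ((onlySpecies sch s₀).a k) ((onlySpecies sch s₀).c (σ i) k) ((onlySpecies sch s₀).m (σ i) k)
        (f i) (torusLift ((onlySpecies sch s₀).side k) U) = 0 := fun U =>
    Finset.prod_eq_zero (Finset.mem_univ i₀) (by rw [h0, smearedLatticeField_zero_c])
  simp_rw [this, integral_zero]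

/-- On the distinguished species the modified scheme has the original lattice functions. [folklore] -/
theorem latticeSchwinger_onlySpecies_self (r : LatticeRep G) (sch : SpeciesScheme (YMSpecies G))
    (s₀ : YMSpecies G) (k n : ℕ) (f : Fin n → 𝓢((EuclideanSpace ℝ (Fin 4)), ℝ)) :
    latticeSchwinger r.ρ (onlySpecies sch s₀) (fun s => s.F) k n (fun _ => s₀) f =
      latticeSchwinger r.ρ sch (fun s => s.F) k n (fun _ => s₀) f := by
  have hc : (onlySpecies sch s₀).c s₀ k = sch.c s₀ k := by simp [onlySpecies]
  unfold latticeSchwinger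
  simp_rw [hc]
  rfl

/-- **Extension**: a one-field witness gives a witness of ALL the crux's clauses — renormalise
every other species to zero and extend the family by zero. [folklore] -/
theorem clauses_of_clauses₁ {r : LatticeRep G} {sch : SpeciesScheme (YMSpecies G)}
    {S₁ : SchwingerFamily (EuclideanSpace ℝ (Fin 4))} (h : ((S₁.toLabelled.IsNormalized ∧ S₁.toLabelled.IsHermitian ∧ S₁.toLabelled.HasLinearGrowth ∧ S₁.toLabelled.IsReflectionPositive ∧
      S₁.toLabelled.IsSymmetric ∧ S₁.toLabelled.HasClusterProperty ∧
      (∀ (n : ℕ) (k : Fin n → Unit) (a : (EuclideanSpace ℝ (Fin 4))) (F : 𝓢((Fin n → (EuclideanSpace ℝ (Fin 4))), ℂ)), IsOffDiagonal F →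
        S₁.toLabelled n k (translateMulti a F) = S₁.toLabelled n k F) ∧
      (∀ (n : ℕ) (k : Fin n → Unit) (R : (EuclideanSpace ℝ (Fin 4)) ≃ₗᵢ[ℝ] (EuclideanSpace ℝ (Fin 4))),
        LinearMap.det (R.toLinearEquiv : (EuclideanSpace ℝ (Fin 4)) →ₗ[ℝ] (EuclideanSpace ℝ (Fin 4))) = 1 →
        (∀ i : Fin 4, ∃ j : Fin 4, R (EuclideanSpace.single i 1) = EuclideanSpace.single j 1 ∨
          R (EuclideanSpace.single i 1) = -EuclideanSpace.single j 1) →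
        ∀ F : 𝓢((Fin n → (EuclideanSpace ℝ (Fin 4))), ℂ), IsOffDiagonal F → S₁.toLabelled n k (linActMulti R F) = S₁.toLabelled n k F)) ∧
    (∀ (n : ℕ), n ≠ 0 → ∀ (f : Fin n → 𝓢((EuclideanSpace ℝ (Fin 4)), ℝ)) (F : 𝓢((Fin n → (EuclideanSpace ℝ (Fin 4))), ℂ)),
      IsTensorOf F (fun i => ofRealTest (f i)) → IsOffDiagonal F →
        Tendsto (fun k : ℕ =>
          ((latticeSchwinger r.ρ sch (fun s => s.F) k n (fun _ => r.curvature) f : ℝ) : ℂ))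
          atTop (𝓝 (S₁ n F))) ∧
    (∃ (F₁ G₁ : 𝓢((Fin 1 → (EuclideanSpace ℝ (Fin 4))), ℂ)) (H₁ : 𝓢((Fin (1 + 1) → (EuclideanSpace ℝ (Fin 4))), ℂ)),
      IsTimeOrdered F₁ ∧ IsTimeOrdered G₁ ∧ IsAppendTensorOf H₁ (osAdjoint F₁) G₁ ∧
        S₁.toLabelled (1 + 1) (fun _ => ()) H₁ ≠ S₁.toLabelled 1 (fun _ => ()) (osAdjoint F₁) * S₁.toLabelled 1 (fun _ => ()) G₁) ∧
    (∃ (f g h : 𝓢((EuclideanSpace ℝ (Fin 4)), ℂ)) (Ffgh : 𝓢((Fin 3 → (EuclideanSpace ℝ (Fin 4))), ℂ)) (Fgh Ffh Ffg : 𝓢((Fin 2 → (EuclideanSpace ℝ (Fin 4))), ℂ))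
      (Ff Fg Fh : 𝓢((Fin 1 → (EuclideanSpace ℝ (Fin 4))), ℂ)),
      IsTensorOf Ffgh ![f, g, h] ∧ IsOffDiagonal Ffgh ∧ IsTensorOf Fgh ![g, h] ∧
      IsTensorOf Ffh ![f, h] ∧ IsTensorOf Ffg ![f, g] ∧ IsTensorOf Ff ![f] ∧ IsTensorOf Fg ![g] ∧
      IsTensorOf Fh ![h] ∧
        S₁.toLabelled 3 (fun _ => ()) Ffgh - S₁.toLabelled 1 (fun _ => ()) Ff * S₁.toLabelled 2 (fun _ => ()) Fgh -
          S₁.toLabelled 1 (fun _ => ()) Fg * S₁.toLabelled 2 (fun _ => ()) Ffh - S₁.toLabelled 1 (fun _ => ()) Fh * S₁.toLabelled 2 (fun _ => ()) Ffg +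
          2 * (S₁.toLabelled 1 (fun _ => ()) Ff * S₁.toLabelled 1 (fun _ => ()) Fg * S₁.toLabelled 1 (fun _ => ()) Fh) ≠ 0) ∧
    (∃ Δ : ℝ, 0 < Δ ∧ S₁.toLabelled.HasMassGap Δ ∧ HasLatticeMassGap r sch Δ))) :
    (((extendByZero r.curvature S₁).IsNormalized ∧ (extendByZero r.curvature S₁).IsHermitian ∧ (extendByZero r.curvature S₁).HasLinearGrowth ∧ (extendByZero r.curvature S₁).IsReflectionPositive ∧
      (extendByZero r.curvature S₁).IsSymmetric ∧ (extendByZero r.curvature S₁).HasClusterProperty ∧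
      (∀ (n : ℕ) (k : Fin n → YMSpecies G) (a : (EuclideanSpace ℝ (Fin 4))) (F : 𝓢((Fin n → (EuclideanSpace ℝ (Fin 4))), ℂ)), IsOffDiagonal F →
        (extendByZero r.curvature S₁) n k (translateMulti a F) = (extendByZero r.curvature S₁) n k F) ∧
      (∀ (n : ℕ) (k : Fin n → YMSpecies G) (R : (EuclideanSpace ℝ (Fin 4)) ≃ₗᵢ[ℝ] (EuclideanSpace ℝ (Fin 4))),
        LinearMap.det (R.toLinearEquiv : (EuclideanSpace ℝ (Fin 4)) →ₗ[ℝ] (EuclideanSpace ℝ (Fin 4))) = 1 →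
        (∀ i : Fin 4, ∃ j : Fin 4, R (EuclideanSpace.single i 1) = EuclideanSpace.single j 1 ∨
          R (EuclideanSpace.single i 1) = -EuclideanSpace.single j 1) →
        ∀ F : 𝓢((Fin n → (EuclideanSpace ℝ (Fin 4))), ℂ), IsOffDiagonal F → (extendByZero r.curvature S₁) n k (linActMulti R F) = (extendByZero r.curvature S₁) n k F)) ∧
    (∀ (n : ℕ), n ≠ 0 → ∀ (σ : Fin n → YMSpecies G) (f : Fin n → 𝓢((EuclideanSpace ℝ (Fin 4)), ℝ))
      (F : 𝓢((Fin n → (EuclideanSpace ℝ (Fin 4))), ℂ)), IsTensorOf F (fun i => ofRealTest (f i)) → IsOffDiagonal F →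
        Tendsto (fun k : ℕ => ((latticeSchwinger r.ρ (onlySpecies sch r.curvature) (fun s => s.F) k n σ f : ℝ) : ℂ))
          atTop (𝓝 ((extendByZero r.curvature S₁) n σ F))) ∧
    (∃ (F₁ G₁ : 𝓢((Fin 1 → (EuclideanSpace ℝ (Fin 4))), ℂ)) (H₁ : 𝓢((Fin (1 + 1) → (EuclideanSpace ℝ (Fin 4))), ℂ)),
      IsTimeOrdered F₁ ∧ IsTimeOrdered G₁ ∧ IsAppendTensorOf H₁ (osAdjoint F₁) G₁ ∧
        (extendByZero r.curvature S₁) (1 + 1) (fun _ => r.curvature) H₁ ≠ (extendByZero r.curvature S₁) 1 (fun _ => r.curvature) (osAdjoint F₁) * (extendByZero r.curvature S₁) 1 (fun _ => r.curvature) G₁) ∧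
    (∃ (f g h : 𝓢((EuclideanSpace ℝ (Fin 4)), ℂ)) (Ffgh : 𝓢((Fin 3 → (EuclideanSpace ℝ (Fin 4))), ℂ)) (Fgh Ffh Ffg : 𝓢((Fin 2 → (EuclideanSpace ℝ (Fin 4))), ℂ))
      (Ff Fg Fh : 𝓢((Fin 1 → (EuclideanSpace ℝ (Fin 4))), ℂ)),
      IsTensorOf Ffgh ![f, g, h] ∧ IsOffDiagonal Ffgh ∧ IsTensorOf Fgh ![g, h] ∧
      IsTensorOf Ffh ![f, h] ∧ IsTensorOf Ffg ![f, g] ∧ IsTensorOf Ff ![f] ∧ IsTensorOf Fg ![g] ∧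
      IsTensorOf Fh ![h] ∧
        (extendByZero r.curvature S₁) 3 (fun _ => r.curvature) Ffgh - (extendByZero r.curvature S₁) 1 (fun _ => r.curvature) Ff * (extendByZero r.curvature S₁) 2 (fun _ => r.curvature) Fgh -
          (extendByZero r.curvature S₁) 1 (fun _ => r.curvature) Fg * (extendByZero r.curvature S₁) 2 (fun _ => r.curvature) Ffh - (extendByZero r.curvature S₁) 1 (fun _ => r.curvature) Fh * (extendByZero r.curvature S₁) 2 (fun _ => r.curvature) Ffg +
          2 * ((extendByZero r.curvature S₁) 1 (fun _ => r.curvature) Ff * (extendByZero r.curvature S₁) 1 (fun _ => r.curvature) Fg * (extendByZero r.curvature S₁) 1 (fun _ => r.curvature) Fh) ≠ 0) ∧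
    (∃ Δ : ℝ, 0 < Δ ∧ (extendByZero r.curvature S₁).HasMassGap Δ ∧ HasLatticeMassGap r (onlySpecies sch r.curvature) Δ)) := by
  obtain ⟨hos, hconv, hnt, hng, Δ, hΔ, hgap, hlat⟩ := h
  refine ⟨osClauses_extendByZero hos, ?_, ?_, ?_, Δ, hΔ, hasMassGap_extendByZero hgap, hlat⟩
  · intro n hn σ f F hF hod
    by_cases hσ : ∀ i, σ i = r.curvature
    · obtain rfl : σ = fun _ => r.curvature := funext hσ
      rw [extendByZero_const]
      simp_rw [latticeSchwinger_onlySpecies_self]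
      exact hconv n hn f F hF hod
    · push Not at hσ
      obtain ⟨i₀, hi₀⟩ := hσ
      rw [extendByZero_of_not_all _ _ (fun hall => hi₀ (hall i₀))]
      simp_rw [latticeSchwinger_onlySpecies_of_ne r sch r.curvature _ n σ f hi₀]
      simp
  · simpa using hnt
  · simpa using hng

/-- **`HypercubicLimit` ⇔ its one-field version.** The labelled, all-species packaging of the
crux (species = ALL gauge-invariant lattice observables, "so that the reconstructed Hilbert space
is that of the whole theory") carries no weight: per-species renormalisations are witness data,
`c_s ≡ 0` silences every species but the curvature, and the extension by zero of a one-field OS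
family is a labelled OS family.  The ONLY all-observable content left is `HasLatticeMassGap`,
which sees `(a_k, β_k, L_k)` alone (§1).  A prover may therefore construct ONE scalar field. [folklore] -/
theorem hypercubicLimit_iff_oneField :
    Summit.QuantumFields.YangMills.Theses.PencilRigidity.HypercubicLimit ↔
      ∀ (G : Type) [Group G] [TopologicalSpace G] [IsTopologicalGroup G] [CompactSpace G],
        IsCompactSimpleLieGroup G →
          letI : MeasurableSpace G := borel G
          haveI : BorelSpace G := ⟨rfl⟩
          ∃ (r : LatticeRep G) (sch : SpeciesScheme (YMSpecies G)) (S₁ : SchwingerFamily (EuclideanSpace ℝ (Fin 4))),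
            ((S₁.toLabelled.IsNormalized ∧ S₁.toLabelled.IsHermitian ∧ S₁.toLabelled.HasLinearGrowth ∧ S₁.toLabelled.IsReflectionPositive ∧
      S₁.toLabelled.IsSymmetric ∧ S₁.toLabelled.HasClusterProperty ∧
      (∀ (n : ℕ) (k : Fin n → Unit) (a : (EuclideanSpace ℝ (Fin 4))) (F : 𝓢((Fin n → (EuclideanSpace ℝ (Fin 4))), ℂ)), IsOffDiagonal F →
        S₁.toLabelled n k (translateMulti a F) = S₁.toLabelled n k F) ∧
      (∀ (n : ℕ) (k : Fin n → Unit) (R : (EuclideanSpace ℝ (Fin 4)) ≃ₗᵢ[ℝ] (EuclideanSpace ℝ (Fin 4))),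
        LinearMap.det (R.toLinearEquiv : (EuclideanSpace ℝ (Fin 4)) →ₗ[ℝ] (EuclideanSpace ℝ (Fin 4))) = 1 →
        (∀ i : Fin 4, ∃ j : Fin 4, R (EuclideanSpace.single i 1) = EuclideanSpace.single j 1 ∨
          R (EuclideanSpace.single i 1) = -EuclideanSpace.single j 1) →
        ∀ F : 𝓢((Fin n → (EuclideanSpace ℝ (Fin 4))), ℂ), IsOffDiagonal F → S₁.toLabelled n k (linActMulti R F) = S₁.toLabelled n k F)) ∧
    (∀ (n : ℕ), n ≠ 0 → ∀ (f : Fin n → 𝓢((EuclideanSpace ℝ (Fin 4)), ℝ)) (F : 𝓢((Fin n → (EuclideanSpace ℝ (Fin 4))), ℂ)),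
      IsTensorOf F (fun i => ofRealTest (f i)) → IsOffDiagonal F →
        Tendsto (fun k : ℕ =>
          ((latticeSchwinger r.ρ sch (fun s => s.F) k n (fun _ => r.curvature) f : ℝ) : ℂ))
          atTop (𝓝 (S₁ n F))) ∧
    (∃ (F₁ G₁ : 𝓢((Fin 1 → (EuclideanSpace ℝ (Fin 4))), ℂ)) (H₁ : 𝓢((Fin (1 + 1) → (EuclideanSpace ℝ (Fin 4))), ℂ)),
      IsTimeOrdered F₁ ∧ IsTimeOrdered G₁ ∧ IsAppendTensorOf H₁ (osAdjoint F₁) G₁ ∧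
        S₁.toLabelled (1 + 1) (fun _ => ()) H₁ ≠ S₁.toLabelled 1 (fun _ => ()) (osAdjoint F₁) * S₁.toLabelled 1 (fun _ => ()) G₁) ∧
    (∃ (f g h : 𝓢((EuclideanSpace ℝ (Fin 4)), ℂ)) (Ffgh : 𝓢((Fin 3 → (EuclideanSpace ℝ (Fin 4))), ℂ)) (Fgh Ffh Ffg : 𝓢((Fin 2 → (EuclideanSpace ℝ (Fin 4))), ℂ))
      (Ff Fg Fh : 𝓢((Fin 1 → (EuclideanSpace ℝ (Fin 4))), ℂ)),
      IsTensorOf Ffgh ![f, g, h] ∧ IsOffDiagonal Ffgh ∧ IsTensorOf Fgh ![g, h] ∧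
      IsTensorOf Ffh ![f, h] ∧ IsTensorOf Ffg ![f, g] ∧ IsTensorOf Ff ![f] ∧ IsTensorOf Fg ![g] ∧
      IsTensorOf Fh ![h] ∧
        S₁.toLabelled 3 (fun _ => ()) Ffgh - S₁.toLabelled 1 (fun _ => ()) Ff * S₁.toLabelled 2 (fun _ => ()) Fgh -
          S₁.toLabelled 1 (fun _ => ()) Fg * S₁.toLabelled 2 (fun _ => ()) Ffh - S₁.toLabelled 1 (fun _ => ()) Fh * S₁.toLabelled 2 (fun _ => ()) Ffg +
          2 * (S₁.toLabelled 1 (fun _ => ()) Ff * S₁.toLabelled 1 (fun _ => ()) Fg * S₁.toLabelled 1 (fun _ => ()) Fh) ≠ 0) ∧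
    (∃ Δ : ℝ, 0 < Δ ∧ S₁.toLabelled.HasMassGap Δ ∧ HasLatticeMassGap r sch Δ)) := by
  unfold Summit.QuantumFields.YangMills.Theses.PencilRigidity.HypercubicLimit
  refine forall_congr' fun G => forall_congr' fun _ => forall_congr' fun _ => forall_congr' fun _ =>
    forall_congr' fun _ => forall_congr' fun _ => ⟨?_, ?_⟩
  · rintro ⟨r, sch, S, h⟩
    letI : MeasurableSpace G := borel G
    haveI : BorelSpace G := ⟨rfl⟩
    exact ⟨r, sch, _, clauses₁_of_clauses h⟩
  · rintro ⟨r, sch, S₁, h⟩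
    letI : MeasurableSpace G := borel G
    haveI : BorelSpace G := ⟨rfl⟩
    exact ⟨r, _, _, clauses_of_clauses₁ h⟩

end OneField

end Summit.QuantumFields.YangMills.Theorems.HypercubicLimit.Negative
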